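import Literature.AlgebraicGeometry.Motives.MumfordTateInvariantsProofs
import Literature.AlgebraicGeometry.Motives.MumfordTateInvariantsScalarExtensionReduction
import HarnessLib

/-!
# `Deligne1982_mumfordTateInvariants_baseChange` holds

Discharge of the named fact `HodgeStructure.Deligne1982_mumfordTateInvariants_baseChange` of
`Literature/AlgebraicGeometry/Motives/MumfordTateInvariants.lean`: for a polarizable pure
`ℚ`-Hodge structure `H` on a finite-dimensional `V` and ANY field `K ⊇ ℚ`, (i) a weight-`0` tensor
in `T^{a,b}_K (K ⊗ V)` fixed by the `K`-points `MT(H)(K) = H.mumfordTateGroupBaseChange K` lies in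
the `K`-span of the base-changed rational Hodge classes of type `(0,0)`, and (ii) every
`MT(H)(K)`-stable `K`-subspace of `T^{a,b}_K (K ⊗ V)` has an `MT(H)(K)`-stable complement
(Deligne, *Hodge cycles on abelian varieties*, LNM 900, I, Prop. 3.4 with its proof and Prop. 3.6,
read on `K`-points).

The proof is the composition of

* the rational case `Deligne1982_mumfordTateInvariants_holds`
  (`MumfordTateInvariantsProofs.lean`: Hodge tensors are the `MT(ℚ)`-invariants and `MT(ℚ)` acts
  completely reducibly on every `T^{a,b}`, via explicit rational unipotent and torus elements of
  `MT` and the induced polarization of `T^{a,b}`), and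
* the descent `ℚ ⇝ K` `Deligne1982_mumfordTateInvariants_baseChange_of_rational`
  (`MumfordTateInvariantsScalarExtensionReduction.lean`: `K ⊗_ℚ T^{a,b} V ≅ T^{a,b}_K (K ⊗ V)` is a
  base change compatible with the actions, fixed points and commutants commute with base change
  over a field, and complete reducibility passes to `K` through the semisimplicity of the
  `K`-span of the image of `MT(ℚ)` in `End (T^{a,b})` and the double-centraliser theorem).

## References

* P. Deligne, *Hodge cycles on abelian varieties* (notes by J. S. Milne), in *Hodge cycles,
  motives, and Shimura varieties*, LNM 900 (1982), I §3, Prop. 3.4 (with proof), Prop. 3.6.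
* A. Borel, *Linear Algebraic Groups*, 2nd ed., GTM 126 (1991), Cor. 18.3 (the density statement
  replaced here by explicit rational points).
-/

noncomputable section

namespace Literature.AlgebraicGeometry.Motives

namespace HodgeStructure

universe u

/-- **Hodge tensors are the Mumford–Tate invariants; complete reducibility — over any field
`K ⊇ ℚ`.** Discharge of `Deligne1982_mumfordTateInvariants_baseChange`: the rational case
(`Deligne1982_mumfordTateInvariants_holds`) descended to `K`-points
(`Deligne1982_mumfordTateInvariants_baseChange_of_rational`).
[cite: Deligne1982HodgeCycles, I Prop. 3.4 (with proof) and Prop. 3.6] -/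
theorem Deligne1982_mumfordTateInvariants_baseChange_holds :
    Deligne1982_mumfordTateInvariants_baseChange.{u} :=
  Deligne1982_mumfordTateInvariants_baseChange_of_rational Deligne1982_mumfordTateInvariants_holds

end HodgeStructure

end Literature.AlgebraicGeometry.Motives

end
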